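import Summits.CriticalPhenomena.SAWScalingLimit.Theorems.SAWSpinMonotoneQCIdentificationXiCycleAux

/-!
# Smirnov's primitive `Ξ = F^{8/5} dz`, V-b: the single boundary cycle — putting back a topmost
face with one lower neighbour, or with two joined ones (helper sub-goal (O) of `stub_rayCondition`,
line `eight_fifths_primitive`, crux `QCIdentification`, stmt-CriticalPhenomena-16772)

**Setting** (`…XiCycleAux`). `T` a finite face set, `f` a function on ports `(x, k)`; the FLANK
CONDITION of `T` for `f` away from a port `p₀`: `f (out-flank) = f (in-flank)` at every arc of `T`
whose out-flank is not `p₀`; CONSTANCY: `f` takes one value on all boundary ports of `T`.  The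
single-cycle theorem (`…XiCycle`) is the implication "flank condition away from any one port ⇒
constancy" (a cycle minus an edge is still connected), proved by induction on `|T|` removing the
topmost face `v`; this file supplies two of the three ways of putting `v` back, as implications
"induction hypothesis for `T ∖ {v}` ⇒ statement for `T`":

* `xi_leaf_step` (registered): `v` has exactly one neighbour `w = hexNbr v (a+2)` in `T` (ports `a`,
  `a+1` outer).  The boundary cycle of `T` is that of `T' = T ∖ {v}` with the port `w → v` replaced by
  the two outer ports of `v`; formally, `f' := f` modified to `f v (a+1)` on the ports pointing into
  `v` satisfies the flank condition of `T'` away from `p₀` (or away from `(w, a+2)` if `p₀` is a port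
  of `v`), by `links_transfer` and the two local links of `T` at the corners `a+1`, `a+2` of `v`;
* `joined_step`: `v` has two lower neighbours `w₁ = hexNbr v a`, `w₂ = hexNbr v (a+1)` joined in
  `T'`, so that (Jordan-type input `FacePot.fp_hexagon_complete_of_joined`, fed in by the caller) the
  hexagon at the corner `a` of `v` is complete: the cycle of `T` is that of `T'` with the consecutive
  ports `w₂ → v`, `w₁ → v` (the two flanks of the five-arc of `T'` at that site) contracted to the
  outer port `(v, a+2)`.

Sources: folklore; H. Duminil-Copin, S. Smirnov, Ann. of Math. 175 (2012) 1653–1665, §3; stub report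
`STUB-REPORT-rayCondition.md` ((O)).  Validated by enumeration
(`work/stubs/scratch_xi/cycle_induction_check.py`).
-/

noncomputable section

open Literature.Probability.LatticeModels Literature.Probability.RandomPlanarGeometry
open Literature.Probability.RandomPlanarGeometry.SAW
open Literature.Barriers.CriticalPhenomena Literature.Barriers.CriticalPhenomena.HexKernel

namespace Summit.CriticalPhenomena.SAWScalingLimit.Cruxes.QCIdentification.EightFifthsPrimitive

namespace Xi

open NB Stokes
open Literature.Probability.Percolation.TriMarkedDomain (fin3_add_one_add_one fin3_add_two_add_one)

/-! ### A topmost face with one neighbour -/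

/-- **Leaf step (registered).** Let `v ∈ T` have its ports `a`, `a+1` pointing outside `T` and
`hexNbr v (a+2) ∈ T`; assume the flank condition of `T` for `f` away from `p₀`, and the induction
hypothesis for `T ∖ {v}` (flank condition away from any port ⇒ constancy, for every function).
Then `f` equals `f v (a+1)` on every boundary port of `T`. -/
theorem xi_leaf_step : ∀ {T : Finset HexVertex} {v : HexVertex} {a : Fin 3} {f : HexVertex → Fin 3 → ℝ} {p₀ : HexVertex × Fin 3}, v ∈ T → hexNbr v a ∉ T → hexNbr v (a + 1) ∉ T → hexNbr v (a + 2) ∈ T → (∀ (s : Site 2) (j m : Fin 6), m ≠ 0 → HexKernel.face s j ∉ T → (∀ i : Fin 6, i < m → HexKernel.face s (j + 1 + i) ∈ T) → HexKernel.face s (j + 1 + m) ∉ T → (HexKernel.face s (j + 1), arcCornerIdx (j + 1) + 1) ≠ p₀ → f (HexKernel.face s (j + 1)) (arcCornerIdx (j + 1) + 1) = f (HexKernel.face s (j + m)) (arcCornerIdx (j + m))) → (∀ (f' : HexVertex → Fin 3 → ℝ) (p' : HexVertex × Fin 3), (∀ (s : Site 2) (j m : Fin 6), m ≠ 0 → HexKernel.face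 s j ∉ T.erase v → (∀ i : Fin 6, i < m → HexKernel.face s (j + 1 + i) ∈ T.erase v) → HexKernel.face s (j + 1 + m) ∉ T.erase v → (HexKernel.face s (j + 1), arcCornerIdx (j + 1) + 1) ≠ p' → f' (HexKernel.face s (j + 1)) (arcCornerIdx (j + 1) + 1) = f' (HexKernel.face s (j + m)) (arcCornerIdx (j + m))) → ∀ (x y : HexVertex) (k k' : Fin 3), x ∈ T.erase v → hexNbr x k ∉ T.erase v → y ∈ T.erase v → hexNbr y k' ∉ T.erase v → f' x k = f' y k') → ∀ (x : HexVertex) (k : Fin 3), x ∈ T → hexNbr x k ∉ T → f x k = f v (a + 1) := by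
  intro T v a f p₀ hv ha ha1 ha2 hL ih
  classical
  set w := hexNbr v (a + 2) with hw
  set c := f v (a + 1) with hc
  set f' : HexVertex → Fin 3 → ℝ := fun x k => if hexNbr x k = v then c else f x k with hf'
  have hf'v : ∀ x k, hexNbr x k = v → f' x k = c := fun x k h => by simp [hf', h]
  have hf'n : ∀ x k, hexNbr x k ≠ v → f' x k = f x k := fun x k h => by simp [hf', h]
  set p' : HexVertex × Fin 3 := if p₀ = (v, a) ∨ p₀ = (v, a + 1) then (w, a + 2) else p₀ with hp'
  have hwv : hexNbr w (a + 2) = v := hexNbr_hexNbr v (a + 2)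
  have hwT' : w ∈ T.erase v := Finset.mem_erase.2 ⟨(adj_hexNbr v (a + 2)).ne', ha2⟩
  have hwp : hexNbr w (a + 2) ∉ T.erase v := by rw [hwv]; exact Finset.notMem_erase v T
  have hcl : ∀ x ∈ T.erase v, ∀ y ∈ T, y ≠ v → hexGraph.Adj x y → y ∈ T.erase v :=
    fun _ _ y hy hyv _ => Finset.mem_erase.2 ⟨hyv, hy⟩
  have hapex : (v, a + 1) ≠ p₀ → f v (a + 1) = f v a := fun h => corner_link hL a hv ha ha1 h
  -- the flank condition on `T ∖ {v}`
  have hL' := links_transfer (X := T.erase v) (f' := f') (p' := p') (Finset.erase_subset v T) hcl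
    hL ?_ hf'v hf'n ?_ ?_
  rotate_left
  · by_cases h : p₀ = (v, a) ∨ p₀ = (v, a + 1)
    · right; rcases h with rfl | rfl <;> exact Finset.notMem_erase v T
    · left; rw [hp', if_neg h]
  · -- arcs of `T ∖ {v}` starting right after `v`: at the corner `a + 2`
    intro s j m hm hvj hi hjm hvl hne
    have h0 : (0 : Fin 6) < m := (Fin.pos_iff_ne_zero' m).2 hm
    have hj1 : face s (j + 1) ∈ T := Finset.mem_of_mem_erase (by simpa using hi 0 h0)
    have e1 : hexNbr v (arcCornerIdx j) = face s (j + 1) := by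
      rw [← hvj]; exact hexNbr_face_arcCornerIdx s j
    have hκ : arcCornerIdx j = a + 2 := by
      rcases fin3_trichotomy a (arcCornerIdx j) with h | h | h
      · exact absurd (by rw [← h, e1]; exact hj1) ha
      · exact absurd (by rw [← h, e1]; exact hj1) ha1
      · exact h
    have hp₀ : ¬(p₀ = (v, a) ∨ p₀ = (v, a + 1)) := by
      intro h
      apply hne
      rw [hp', if_pos h]
      have hfw : face s (j + 1) = w := by rw [← e1, hκ]
      have hk : arcCornerIdx (j + 1) + 1 = a + 2 := by
        by_contra hne'
        apply hexNbr_ne w hne'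
        rw [hwv, ← hfw, hexNbr_face_arcCornerIdx_succ, add_sub_cancel_right, hvj]
      rw [hfw, hk]
    have hm1 : m + 1 ≠ 0 := by
      intro h0'
      apply hvl
      rw [show j + 1 + m = j + (m + 1) by abel, h0', add_zero, hvj]
    have h1 : face s (j - 1) ∉ T := by
      rw [← hexNbr_face_arcCornerIdx_succ s j, hvj, hκ, fin3_add_two_add_one]; exact ha
    have h2 : ∀ i : Fin 6, i < m + 1 → face s (j - 1 + 1 + i) ∈ T := by
      intro i hi'
      rw [sub_add_cancel]
      rcases fin6_lt_add_one_add 0 m i (by rw [zero_add, add_comm]; exact hi') with h | h | ⟨i', hi'', rfl⟩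
      · exact absurd h (fin6_not_lt_zero i)
      · rw [h, add_zero, hvj]; exact hv
      · rw [show j + (0 + 1 + i') = j + 1 + i' by abel]
        exact Finset.mem_of_mem_erase (hi i' hi'')
    have h3 : face s (j - 1 + 1 + (m + 1)) ∉ T := by
      rw [sub_add_cancel, show j + (m + 1) = j + 1 + m by abel]
      exact fun h => hjm (Finset.mem_erase.2 ⟨hvl, h⟩)
    have h4 : (face s (j - 1 + 1), arcCornerIdx (j - 1 + 1) + 1) ≠ p₀ := by
      rw [sub_add_cancel, hvj, hκ, fin3_add_two_add_one]
      exact fun h => hp₀ (Or.inl h.symm)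
    have link := hL s (j - 1) (m + 1) hm1 h1 h2 h3 h4
    rw [sub_add_cancel, hvj, hκ, fin3_add_two_add_one, show j - 1 + (m + 1) = j + m by abel] at link
    rw [hc, hapex (fun h => hp₀ (Or.inr h.symm)), link]
  · -- arcs of `T ∖ {v}` ending right before `v`: at the corner `a + 1`
    intro s j m hm hj hvj hi hvl hne
    have h0 : (0 : Fin 6) < m := (Fin.pos_iff_ne_zero' m).2 hm
    have hmT : face s (j + m) ∈ T := by
      have h := hi (m - 1) (Fin.sub_one_lt_iff.2 h0)
      rw [show j + 1 + (m - 1) = j + m by abel] at h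
      exact Finset.mem_of_mem_erase h
    have e1 : hexNbr v (arcCornerIdx (j + 1 + m) + 1) = face s (j + m) := by
      rw [← hvl, hexNbr_face_arcCornerIdx_succ, show j + 1 + m - 1 = j + m by abel]
    have hκ : arcCornerIdx (j + 1 + m) = a + 1 := by
      rcases fin3_trichotomy a (arcCornerIdx (j + 1 + m)) with h | h | h
      · exact absurd (by rw [← h, e1]; exact hmT) ha1
      · exact h
      · exact absurd (by rw [← fin3_add_two_add_one a, ← h, e1]; exact hmT) ha
    have hm1 : m + 1 ≠ 0 := by
      intro h0'
      apply hvj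
      rw [← hvl, show j + 1 + m = j + (m + 1) by abel, h0', add_zero]
    have hjT : face s j ∉ T := fun h => hj (Finset.mem_erase.2 ⟨hvj, h⟩)
    have h2 : ∀ i : Fin 6, i < m + 1 → face s (j + 1 + i) ∈ T := by
      intro i hi'
      rcases fin6_lt_add_one_add m 0 i (by simpa using hi') with h | h | ⟨i', hi'', -⟩
      · exact Finset.mem_of_mem_erase (hi i h)
      · rw [h, hvl]; exact hv
      · exact absurd hi'' (fin6_not_lt_zero i')
    have h3 : face s (j + 1 + (m + 1)) ∉ T := by
      rw [show j + 1 + (m + 1) = j + 1 + m + 1 by abel, ← hexNbr_face_arcCornerIdx, hvl, hκ]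
      exact ha1
    have h4 : (face s (j + 1), arcCornerIdx (j + 1) + 1) ≠ p₀ := by
      by_cases h : p₀ = (v, a) ∨ p₀ = (v, a + 1)
      · have hj1v : face s (j + 1) ≠ v :=
          (Finset.mem_erase.1 (by simpa using hi 0 h0 : face s (j + 1) ∈ T.erase v)).1
        rcases h with rfl | rfl <;> exact fun e => hj1v (congrArg Prod.fst e)
      · rwa [hp', if_neg h] at hne
    have link := hL s j (m + 1) hm1 hjT h2 h3 h4
    rw [show j + (m + 1) = j + 1 + m by abel, hvl, hκ] at link
    rw [hc]; exact link
  -- constancy on `T ∖ {v}` and on `T`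
  have hconst := ih f' p' hL'
  have hcw : f' w (a + 2) = c := hf'v w (a + 2) hwv
  have hB : ∀ x k, x ∈ T.erase v → hexNbr x k ∉ T → f x k = c := by
    intro x k hx hxk
    rw [← hf'n x k (fun h => hxk (h ▸ hv)), ← hcw]
    exact hconst x w k (a + 2) hx (fun h => hxk (Finset.mem_of_mem_erase h)) hwT' hwp
  intro x k hx hxk
  by_cases hxv : x = v
  · rw [hxv] at hxk ⊢
    rcases fin3_trichotomy a k with rfl | rfl | rfl
    · -- the port `a`: through the apex link, or (if that one is cut) around the corner `a + 2`
      by_cases hpa : p₀ = (v, k + 1)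
      · obtain ⟨l, hl, hκ⟩ := s4_exists_face_eq_of_corner v (k + 2)
        set S := Dev.triVert v (k + 2 + 1) with hS
        have h1 : face S (l - 1) ∉ T := by
          rw [← hexNbr_face_arcCornerIdx_succ S l, hl, hκ, fin3_add_two_add_one]; exact ha
        have h2 : face S (l - 1 + 1) ∈ T := by rw [sub_add_cancel, hl]; exact hv
        obtain ⟨m, hm, hi, hend⟩ := xi_exists_arc_from T S (l - 1) h1 h2
        have h4 : (face S (l - 1 + 1), arcCornerIdx (l - 1 + 1) + 1) ≠ p₀ := by
          rw [sub_add_cancel, hl, hκ, fin3_add_two_add_one, hpa]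
          exact fun h => fin3_ne_add_one k (congrArg Prod.snd h)
        have link := hL S (l - 1) m hm h1 hi hend h4
        rw [sub_add_cancel, hl, hκ, fin3_add_two_add_one] at link
        have hqT : face S (l - 1 + m) ∈ T := by
          have h := hi (m - 1) (Fin.sub_one_lt_iff.2 ((Fin.pos_iff_ne_zero' m).2 hm))
          rwa [show l - 1 + 1 + (m - 1) = l - 1 + m by abel] at h
        have hqn : hexNbr (face S (l - 1 + m)) (arcCornerIdx (l - 1 + m)) ∉ T := by
          rw [hexNbr_face_arcCornerIdx, show l - 1 + m + 1 = l - 1 + 1 + m by abel]; exact hend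
        have hqv : face S (l - 1 + m) ≠ v := by
          intro h
          have hm1 : m = 1 := fin6_eq_one_of l m ((face_inj S _ _).1 (h.trans hl.symm))
          apply (show face S (l - 1 + 1 + m) ∉ T from hend)
          rw [hm1, sub_add_cancel, ← hexNbr_face_arcCornerIdx, hl, hκ]; exact ha2
        rw [link]
        exact hB _ _ (Finset.mem_erase.2 ⟨hqv, hqT⟩) hqn
      · rw [← hapex (fun h => hpa h.symm)]
    · rfl
    · exact absurd ha2 hxk
  · exact hB x k (Finset.mem_erase.2 ⟨hxv, hx⟩) hxk

/-! ### A topmost face with two joined neighbours -/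

/-- **Joined step.** Let `v = face S l ∈ T` (`arcCornerIdx l = a`) have `hexNbr v a`,
`hexNbr v (a+1) ∈ T` and `hexNbr v (a+2) ∉ T`, and let the hexagon at `S` be complete in `T`;
assume the flank condition of `T` for `f` away from `p₀` and the induction hypothesis for
`T ∖ {v}`.  Then `f` equals `f v (a+2)` on every boundary port of `T`. -/
theorem joined_step {T : Finset HexVertex} {v : HexVertex} {a : Fin 3} {f : HexVertex → Fin 3 → ℝ}
    {p₀ : HexVertex × Fin 3} {S : Site 2} {l : Fin 6} (hv : v ∈ T) (ha : hexNbr v a ∈ T)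
    (ha1 : hexNbr v (a + 1) ∈ T) (ha2 : hexNbr v (a + 2) ∉ T) (hl : face S l = v)
    (hκ : arcCornerIdx l = a) (hfull : ∀ j : Fin 6, face S j ∈ T)
    (hL : ∀ (s : Site 2) (j m : Fin 6), m ≠ 0 → face s j ∉ T →
      (∀ i : Fin 6, i < m → face s (j + 1 + i) ∈ T) → face s (j + 1 + m) ∉ T →
      (face s (j + 1), arcCornerIdx (j + 1) + 1) ≠ p₀ →
      f (face s (j + 1)) (arcCornerIdx (j + 1) + 1) = f (face s (j + m)) (arcCornerIdx (j + m)))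
    (ih : ∀ (f' : HexVertex → Fin 3 → ℝ) (p' : HexVertex × Fin 3),
      (∀ (s : Site 2) (j m : Fin 6), m ≠ 0 → face s j ∉ T.erase v →
        (∀ i : Fin 6, i < m → face s (j + 1 + i) ∈ T.erase v) → face s (j + 1 + m) ∉ T.erase v →
        (face s (j + 1), arcCornerIdx (j + 1) + 1) ≠ p' →
        f' (face s (j + 1)) (arcCornerIdx (j + 1) + 1) = f' (face s (j + m)) (arcCornerIdx (j + m))) →
      ∀ (x y : HexVertex) (k k' : Fin 3), x ∈ T.erase v → hexNbr x k ∉ T.erase v →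
        y ∈ T.erase v → hexNbr y k' ∉ T.erase v → f' x k = f' y k') :
    ∀ (x : HexVertex) (k : Fin 3), x ∈ T → hexNbr x k ∉ T → f x k = f v (a + 2) := by
  classical
  set w₂ := hexNbr v (a + 1) with hw₂
  set c := f v (a + 2) with hc
  set f' : HexVertex → Fin 3 → ℝ := fun x k => if hexNbr x k = v then c else f x k with hf'
  have hf'v : ∀ x k, hexNbr x k = v → f' x k = c := fun x k h => by simp [hf', h]
  have hf'n : ∀ x k, hexNbr x k ≠ v → f' x k = f x k := fun x k h => by simp [hf', h]
  set p' : HexVertex × Fin 3 := if p₀ = (v, a + 2) then (w₂, a + 1) else p₀ with hp'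
  have hwv : hexNbr w₂ (a + 1) = v := hexNbr_hexNbr v (a + 1)
  have hwT' : w₂ ∈ T.erase v := Finset.mem_erase.2 ⟨(adj_hexNbr v (a + 1)).ne', ha1⟩
  have hwp : hexNbr w₂ (a + 1) ∉ T.erase v := by rw [hwv]; exact Finset.notMem_erase v T
  have hcl : ∀ x ∈ T.erase v, ∀ y ∈ T, y ≠ v → hexGraph.Adj x y → y ∈ T.erase v :=
    fun _ _ y hy hyv _ => Finset.mem_erase.2 ⟨hyv, hy⟩
  have hL' := links_transfer (X := T.erase v) (f' := f') (p' := p') (Finset.erase_subset v T) hcl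
    hL ?_ hf'v hf'n ?_ ?_
  rotate_left
  · by_cases h : p₀ = (v, a + 2)
    · right; rw [h]; exact Finset.notMem_erase v T
    · left; rw [hp', if_neg h]
  · -- arcs of `T ∖ {v}` starting right after `v`
    intro s j m hm hvj hi hjm hvl hne
    have h0 : (0 : Fin 6) < m := (Fin.pos_iff_ne_zero' m).2 hm
    have hj1 : face s (j + 1) ∈ T := Finset.mem_of_mem_erase (by simpa using hi 0 h0)
    have e1 : hexNbr v (arcCornerIdx j) = face s (j + 1) := by
      rw [← hvj]; exact hexNbr_face_arcCornerIdx s j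
    rcases fin3_trichotomy a (arcCornerIdx j) with h | h | h
    · -- the corner `a`: the site `S`, whose hexagon is complete
      obtain ⟨rfl, rfl⟩ := site_eq_of_face_eq (hvj.trans hl.symm) (h.trans hκ.symm)
      exact absurd (Finset.mem_erase.2 ⟨hvl, hfull _⟩) hjm
    · -- the corner `a + 1`
      have hp₀ : p₀ ≠ (v, a + 2) := by
        intro hp
        apply hne
        rw [hp', if_pos hp]
        have hfw : face s (j + 1) = w₂ := by rw [← e1, h]
        have hk : arcCornerIdx (j + 1) + 1 = a + 1 := by
          by_contra hne'
          apply hexNbr_ne w₂ hne'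
          rw [hwv, ← hfw, hexNbr_face_arcCornerIdx_succ, add_sub_cancel_right, hvj]
        rw [hfw, hk]
      have hm1 : m + 1 ≠ 0 := by
        intro h0'
        apply hvl
        rw [show j + 1 + m = j + (m + 1) by abel, h0', add_zero, hvj]
      have h1 : face s (j - 1) ∉ T := by
        rw [← hexNbr_face_arcCornerIdx_succ s j, hvj, h, fin3_add_one_add_one]; exact ha2
      have h2 : ∀ i : Fin 6, i < m + 1 → face s (j - 1 + 1 + i) ∈ T := by
        intro i hi'
        rw [sub_add_cancel]
        rcases fin6_lt_add_one_add 0 m i (by rw [zero_add, add_comm]; exact hi') with h' | h' | ⟨i', hi'', rfl⟩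
        · exact absurd h' (fin6_not_lt_zero i)
        · rw [h', add_zero, hvj]; exact hv
        · rw [show j + (0 + 1 + i') = j + 1 + i' by abel]
          exact Finset.mem_of_mem_erase (hi i' hi'')
      have h3 : face s (j - 1 + 1 + (m + 1)) ∉ T := by
        rw [sub_add_cancel, show j + (m + 1) = j + 1 + m by abel]
        exact fun h' => hjm (Finset.mem_erase.2 ⟨hvl, h'⟩)
      have h4 : (face s (j - 1 + 1), arcCornerIdx (j - 1 + 1) + 1) ≠ p₀ := by
        rw [sub_add_cancel, hvj, h, fin3_add_one_add_one]
        exact fun h' => hp₀ h'.symm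
      have link := hL s (j - 1) (m + 1) hm1 h1 h2 h3 h4
      rw [sub_add_cancel, hvj, h, fin3_add_one_add_one, show j - 1 + (m + 1) = j + m by abel]
        at link
      rw [hc, link]
    · exact absurd (by rw [← h, e1]; exact hj1) ha2
  · -- arcs of `T ∖ {v}` ending right before `v`
    intro s j m hm hj hvj hi hvl hne
    have h0 : (0 : Fin 6) < m := (Fin.pos_iff_ne_zero' m).2 hm
    have hmT : face s (j + m) ∈ T := by
      have h := hi (m - 1) (Fin.sub_one_lt_iff.2 h0)
      rw [show j + 1 + (m - 1) = j + m by abel] at h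
      exact Finset.mem_of_mem_erase h
    have e1 : hexNbr v (arcCornerIdx (j + 1 + m) + 1) = face s (j + m) := by
      rw [← hvl, hexNbr_face_arcCornerIdx_succ, show j + 1 + m - 1 = j + m by abel]
    rcases fin3_trichotomy a (arcCornerIdx (j + 1 + m)) with h | h | h
    · -- the corner `a`: the site `S`, complete hexagon, so `face s j = v`
      obtain ⟨rfl, -⟩ := site_eq_of_face_eq (hvl.trans hl.symm) (h.trans hκ.symm)
      exact absurd (Finset.mem_erase.2 ⟨hvj, hfull j⟩) hj
    · exact absurd (by rw [← fin3_add_one_add_one, ← h, e1]; exact hmT) ha2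
    · -- the corner `a + 2`
      have hm1 : m + 1 ≠ 0 := by
        intro h0'
        apply hvj
        rw [← hvl, show j + 1 + m = j + (m + 1) by abel, h0', add_zero]
      have hjT : face s j ∉ T := fun h' => hj (Finset.mem_erase.2 ⟨hvj, h'⟩)
      have h2 : ∀ i : Fin 6, i < m + 1 → face s (j + 1 + i) ∈ T := by
        intro i hi'
        rcases fin6_lt_add_one_add m 0 i (by simpa using hi') with h' | h' | ⟨i', hi'', -⟩
        · exact Finset.mem_of_mem_erase (hi i h')
        · rw [h', hvl]; exact hv
        · exact absurd hi'' (fin6_not_lt_zero i')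
      have h3 : face s (j + 1 + (m + 1)) ∉ T := by
        rw [show j + 1 + (m + 1) = j + 1 + m + 1 by abel, ← hexNbr_face_arcCornerIdx, hvl, h]
        exact ha2
      have h4 : (face s (j + 1), arcCornerIdx (j + 1) + 1) ≠ p₀ := by
        by_cases hp : p₀ = (v, a + 2)
        · have hj1v : face s (j + 1) ≠ v :=
            (Finset.mem_erase.1 (by simpa using hi 0 h0 : face s (j + 1) ∈ T.erase v)).1
          rw [hp]; exact fun e => hj1v (congrArg Prod.fst e)
        · rwa [hp', if_neg hp] at hne
      have link := hL s j (m + 1) hm1 hjT h2 h3 h4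
      rw [show j + (m + 1) = j + 1 + m by abel, hvl, h] at link
      rw [hc]; exact link
  -- constancy on `T ∖ {v}` and on `T`
  have hconst := ih f' p' hL'
  have hcw : f' w₂ (a + 1) = c := hf'v w₂ (a + 1) hwv
  have hB : ∀ x k, x ∈ T.erase v → hexNbr x k ∉ T → f x k = c := by
    intro x k hx hxk
    rw [← hf'n x k (fun h => hxk (h ▸ hv)), ← hcw]
    exact hconst x w₂ k (a + 1) hx (fun h => hxk (Finset.mem_of_mem_erase h)) hwT' hwp
  intro x k hx hxk
  by_cases hxv : x = v
  · rw [hxv] at hxk ⊢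
    rcases fin3_trichotomy a k with rfl | rfl | rfl
    · exact absurd ha hxk
    · exact absurd ha1 hxk
    · rfl
  · exact hB x k (Finset.mem_erase.2 ⟨hxv, hx⟩) hxk

end Xi

end Summit.CriticalPhenomena.SAWScalingLimit.Cruxes.QCIdentification.EightFifthsPrimitive

end
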